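import Mathlib
import HarnessLib
import Summits.NavierStokesRegularity.NavierStokesRegularity.Theorems.TypeIQuarterGateScarEnvelopeTypeIForcedTsaiAlgCertG
import Summits.NavierStokesRegularity.NavierStokesRegularity.Theorems.TypeIQuarterGateScarEnvelopeTypeIForcedTsaiAlgMomentsRadial

/-!
# ARM B lane E-exact, Type-I-tail class — MOMENT LEMMAS III: the EXACT ODD MOMENT
  `∫_{ℝ³} |y|·(c·y^a t^k v^h) dy = momentOddQ τ m · π` behind `Poly5.integrateOdd` (LANEX-ALG v3, `…ForcedTsaiAlgCertG`)

* `norm_mul_eval_eq_polar` — `|y|·Mono5.eval = (direction monomial)·(c·radial profile at |y|)`;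
* `integral_mono5_odd` — for a 5-monomial with `convOdd` (`h > |a|+2k+4`) and rational `τ > 0`:
  `y ↦ |y|·(c y^a t^k v^h)` is integrable on `ℝ³` and integrates to `momentOddQ τ m · π`
  (polar factorisation `integral_polar3`, sphere moment `sphMono_eq`, radial Beta `integral_radialBeta` of
  `…AlgMomentsRadial`, then the `Γ(n/2) ↔ ghalf n` bookkeeping — the `√π` factors cancel by parity);
* `integral_poly5_odd` — the list version: `Poly5.integrateOdd τ P = some c →
  Integrable (|y|·Poly5.eval τ P) ∧ ∫ |y|·Poly5.eval τ P = c·π`.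
Nothing here bears on NS regularity.
-/

noncomputable section

set_option linter.dupNamespace false

namespace Summit.NavierStokesRegularity.NavierStokesRegularity.Cruxes.ScarEnvelopeTypeI.ForcedTsai

open MeasureTheory Set Metric Real Finset
open scoped RealInnerProductSpace

/-! ## The exact odd moment of a 5-monomial -/

/-- `ghalf n > 0` (as a real number), `n ≥ 1`. -/
theorem ghalf_cast_pos (n : ℕ) (hn : 1 ≤ n) : 0 < (ghalf n : ℝ) := by
  have h := Gamma_half_eq_ghalf n hn
  have hG : 0 < Real.Gamma ((n : ℝ) / 2) :=
    Real.Gamma_pos_of_pos (div_pos (by exact_mod_cast (show 0 < n by omega)) two_pos)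
  have hs : 0 < (if n % 2 = 1 then √π else (1 : ℝ)) := by
    split_ifs
    · exact Real.sqrt_pos.2 Real.pi_pos
    · exact one_pos
  rw [h] at hG
  exact (mul_pos_iff_of_pos_right hs).mp hG

/-- The radial profile of `|y|·(y^a t^k v^h)` without its coefficient: `r ↦ r^{|a|+2k+1}(1+r²/τ²)^{−h/2}`. -/
def radO (τ : ℝ) (m : Mono5) (r : ℝ) : ℝ :=
  r ^ (m.e1 + m.e2 + m.e3 + 2 * m.et + 1) * (1 + r ^ 2 / τ ^ 2) ^ (-(m.eh : ℝ) / 2)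

/-- `radO ≥ 0` on `r ≥ 0`. -/
theorem radO_nonneg (τ : ℝ) (m : Mono5) {r : ℝ} (hr : 0 ≤ r) : 0 ≤ radO τ m r := by
  unfold radO
  have : 0 < 1 + r ^ 2 / τ ^ 2 := by positivity
  positivity

/-- **Polar form of `|y|·Mono5.eval`**: direction monomial × (coefficient · radial profile at `|y|`). -/
theorem norm_mul_eval_eq_polar (τ : ℝ) (m : Mono5) (y : E3) :
    ‖y‖ * Mono5.eval τ m y =
      (∏ j : Fin 3, ((‖y‖⁻¹ • y) j) ^ m.yMono.exp j) * ((m.c : ℝ) * radO τ m ‖y‖) := by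
  have hprod : (m.c : ℝ) * y 0 ^ m.e1 * y 1 ^ m.e2 * y 2 ^ m.e3 = Mono.eval m.yMono y := rfl
  rw [Mono5.eval, hprod, Mono.eval_eq_prod, ← dir_prod_pow_mul y m.yMono, vpow, kbase, radO]
  simp only [Mono5.yMono]
  ring

/-- The direction monomial is bounded by `1` in absolute value. -/
theorem abs_dir_prod_pow_le_one (y : E3) (m : Mono) : |∏ j : Fin 3, ((‖y‖⁻¹ • y) j) ^ m.exp j| ≤ 1 := by
  have hdir : ∀ j : Fin 3, |((‖y‖⁻¹ • y) j)| ≤ 1 := fun j => by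
    rw [PiLp.smul_apply, smul_eq_mul, abs_mul, abs_inv, abs_norm]
    rcases eq_or_ne y 0 with rfl | hy
    · simp
    · rw [inv_mul_le_iff₀ (norm_pos_iff.mpr hy), mul_one]
      simpa using PiLp.norm_apply_le y j
  rw [Finset.abs_prod]
  refine Finset.prod_le_one (fun j _ => abs_nonneg _) fun j _ => ?_
  rw [abs_pow]
  exact pow_le_one₀ (abs_nonneg _) (hdir j)

/-- **Exact odd moment of a 5-monomial**: for `h > |a| + 2k + 4` (`convOdd`) and rational `τ > 0`,
`y ↦ |y|·(c y^a t^k v^h)` is integrable on `ℝ³` and `∫ |y|·(c y^a t^k v^h) dy = momentOddQ τ m · π`. -/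
theorem integral_mono5_odd {τq : ℚ} (hτq : 0 < τq) (m : Mono5) (hconv : m.convOdd = true) :
    Integrable (fun y : E3 => ‖y‖ * Mono5.eval (τq : ℝ) m y) ∧
      ∫ y : E3, ‖y‖ * Mono5.eval (τq : ℝ) m y = (m.momentOddQ τq : ℝ) * π := by
  set τ : ℝ := (τq : ℝ) with hτdef
  have hτ : 0 < τ := by rw [hτdef]; exact_mod_cast hτq
  simp only [Mono5.convOdd, decide_eq_true_eq] at hconv
  have hrad := integral_radialBeta τ hτ (m.e1 + m.e2 + m.e3 + 2 * m.et + 3) m.eh (by omega)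
  have hfun : (fun y : E3 => ‖y‖ * Mono5.eval τ m y) =
      fun y => (∏ j : Fin 3, ((‖y‖⁻¹ • y) j) ^ m.yMono.exp j) * ((m.c : ℝ) * radO τ m ‖y‖) :=
    funext (norm_mul_eval_eq_polar τ m)
  -- the radial integral of the profile (with the Jacobian r²)
  have hradfun : ∀ r : ℝ, r ^ 2 * ((m.c : ℝ) * radO τ m r) =
      (m.c : ℝ) * (r ^ (m.e1 + m.e2 + m.e3 + 2 * m.et + 3) * (1 + r ^ 2 / τ ^ 2) ^ (-(m.eh : ℝ) / 2)) := by
    intro r; simp only [radO]; ring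
  constructor
  · -- INTEGRABILITY: continuous, dominated by |c|·radO(|y|), which is integrable by the radial Beta integral
    have hcont : Continuous fun y : E3 => ‖y‖ * Mono5.eval τ m y := continuous_norm.mul (Mono5.continuous_eval τ m)
    have h1 : Integrable (fun y : E3 => radO τ m ‖y‖) := by
      rw [integrable_fun_norm_addHaar (volume : Measure E3) (f := radO τ m), finrank_euclideanSpace_fin]
      refine hrad.1.congr_fun (fun r _ => ?_) measurableSet_Ioi
      simp only [radO, smul_eq_mul]; ring
    refine (h1.const_mul |(m.c : ℝ)|).mono' hcont.aestronglyMeasurable (Filter.Eventually.of_forall fun y => ?_)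
    rw [norm_mul_eval_eq_polar τ m y, Real.norm_eq_abs, abs_mul, abs_mul, abs_of_nonneg (radO_nonneg τ m (norm_nonneg y))]
    have hP := abs_dir_prod_pow_le_one y m.yMono
    have hR := radO_nonneg τ m (norm_nonneg y)
    calc |∏ j : Fin 3, ((‖y‖⁻¹ • y) j) ^ m.yMono.exp j| * (|(m.c : ℝ)| * radO τ m ‖y‖)
        ≤ 1 * (|(m.c : ℝ)| * radO τ m ‖y‖) := mul_le_mul_of_nonneg_right hP (by positivity)
      _ = |(m.c : ℝ)| * radO τ m ‖y‖ := one_mul _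
  · -- VALUE: polar factorisation, sphere moment, radial Beta integral, Gamma ↔ ghalf bookkeeping
    rw [hfun, integral_polar3 (fun θ : E3 => ∏ j : Fin 3, (θ j) ^ m.yMono.exp j) (fun r : ℝ => (m.c : ℝ) * radO τ m r)]
    have hradint : ∫ r in Ioi (0 : ℝ), r ^ 2 * ((m.c : ℝ) * radO τ m r) =
        (m.c : ℝ) * (τ ^ (m.e1 + m.e2 + m.e3 + 2 * m.et + 3 + 1) / 2 *
          Real.Gamma ((((m.e1 + m.e2 + m.e3 + 2 * m.et + 3 : ℕ) : ℝ) + 1) / 2) *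
          Real.Gamma ((((m.eh - (m.e1 + m.e2 + m.e3 + 2 * m.et + 3 + 1) : ℕ) : ℝ)) / 2) /
          Real.Gamma ((m.eh : ℝ) / 2)) := by
      rw [← hrad.2, ← integral_const_mul]
      exact setIntegral_congr_fun measurableSet_Ioi fun r _ => hradfun r
    rw [show (∫ θ : sphere (0 : E3) 1, (fun θ : E3 => ∏ j : Fin 3, (θ j) ^ m.yMono.exp j) θ
      ∂((volume : Measure E3).toSphere)) = sphMono m.yMono from rfl, sphMono_eq, hradint]
    simp only [Mono5.yMono]
    unfold Mono5.momentOddQ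
    by_cases he : m.e1 % 2 = 1 ∨ m.e2 % 2 = 1 ∨ m.e3 % 2 = 1
    · rw [if_pos he, if_pos he]; simp
    · rw [if_neg he, if_neg he]
      set A : ℕ := m.e1 + m.e2 + m.e3 with hA
      set h : ℕ := m.eh with hh
      have hA2 : A % 2 = 0 := by omega
      -- Γ((n+1)/2) with n+1 = A+2k+4 even
      have hG1 : Real.Gamma ((((A + 2 * m.et + 3 : ℕ) : ℝ) + 1) / 2) = (ghalf (A + 2 * m.et + 4) : ℝ) := by
        have := Gamma_half_eq_ghalf (A + 2 * m.et + 4) (by omega)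
        rw [if_neg (by omega), mul_one] at this
        rw [← this]; congr 1; push_cast; ring
      have hsub : h - (A + 2 * m.et + 3 + 1) = h - (A + 2 * m.et + 4) := by omega
      have hG2 : Real.Gamma ((((h - (A + 2 * m.et + 3 + 1) : ℕ) : ℝ)) / 2) =
          (ghalf (h - (A + 2 * m.et + 4)) : ℝ) * (if (h - (A + 2 * m.et + 4)) % 2 = 1 then √π else 1) := by
        rw [hsub]; exact Gamma_half_eq_ghalf _ (by omega)
      have hG3 : Real.Gamma ((h : ℝ) / 2) = (ghalf h : ℝ) * (if h % 2 = 1 then √π else 1) :=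
        Gamma_half_eq_ghalf h (by omega)
      have hpar : (h - (A + 2 * m.et + 4)) % 2 = h % 2 := by omega
      rw [hG1, hG2, hG3, hpar, show A + 2 * m.et + 3 + 1 = A + 2 * m.et + 4 by ring]
      have hgA : (ghalf (A + 3) : ℝ) ≠ 0 := (ghalf_cast_pos _ (by omega)).ne'
      have hgh : (ghalf h : ℝ) ≠ 0 := (ghalf_cast_pos _ (by omega)).ne'
      have hsp : √π ≠ 0 := (Real.sqrt_pos.2 Real.pi_pos).ne'
      push_cast
      rw [← hτdef]
      by_cases hp : h % 2 = 1
      · rw [if_pos hp]; field_simp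
      · rw [if_neg hp]; field_simp

/-! ## Lists: `Poly5.integrateOdd` -/

/-- All-`convOdd` lists are integrable against `|y|` with the summed odd moments. -/
theorem integral_list_mono5_odd {τq : ℚ} (hτq : 0 < τq) (E : Poly5) (hall : E.all Mono5.convOdd = true) :
    Integrable (fun y : E3 => ‖y‖ * Poly5.eval (τq : ℝ) E y) ∧
      ∫ y : E3, ‖y‖ * Poly5.eval (τq : ℝ) E y = (((E.map (Mono5.momentOddQ τq)).sum : ℚ) : ℝ) * π := by
  induction E with
  | nil => simp
  | cons m E ih =>
    rw [List.all_cons, Bool.and_eq_true] at hall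
    obtain ⟨hmi, hmv⟩ := integral_mono5_odd hτq m hall.1
    obtain ⟨hEi, hEv⟩ := ih hall.2
    have hsplit : (fun y : E3 => ‖y‖ * Poly5.eval (τq : ℝ) (m :: E) y) =
        fun y => ‖y‖ * Mono5.eval (τq : ℝ) m y + ‖y‖ * Poly5.eval (τq : ℝ) E y := by
      funext y; rw [Poly5.eval_cons, mul_add]
    rw [hsplit]
    refine ⟨hmi.add hEi, ?_⟩
    rw [integral_add hmi hEi, hmv, hEv, List.map_cons, List.sum_cons]
    push_cast; ring

/-- **`Poly5.integrateOdd` is sound**: `integrateOdd τ P = some c` gives integrability of `|y|·Poly5.eval τ P`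
on `ℝ³` and `∫ |y|·Poly5.eval τ P = c·π` (`τ > 0`). -/
theorem integral_poly5_odd {τq : ℚ} (hτq : 0 < τq) (P : Poly5) {c : ℚ} (hP : Poly5.integrateOdd τq P = some c) :
    Integrable (fun y : E3 => ‖y‖ * Poly5.eval (τq : ℝ) P y) ∧
      ∫ y : E3, ‖y‖ * Poly5.eval (τq : ℝ) P y = (c : ℝ) * π := by
  unfold Poly5.integrateOdd at hP
  split_ifs at hP with hall
  cases hP
  exact integral_list_mono5_odd hτq P hall

end Summit.NavierStokesRegularity.NavierStokesRegularity.Cruxes.ScarEnvelopeTypeI.ForcedTsai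

end
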